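import Literature.Geometry.Riemannian.NonTrappingExitTime
import Literature.Geometry.Riemannian.ExpMapDifferential
import Literature.Geometry.Riemannian.ExponentialMapProofs
import Literature.Geometry.Riemannian.HopfRinowCompact
import Literature.Geometry.Riemannian.SimpleManifoldBallStarShaped
import Literature.Geometry.Riemannian.CartanHadamardLift
import Mathlib.Analysis.Convex.Star
import Mathlib.Analysis.Calculus.Deriv.Slope
import Mathlib.Analysis.Calculus.MeanValue
import HarnessLib

/-!
# Exit structure of the geodesic rays of a non-trapping manifold which is convex near infinity

Support file (everything proved, no definitions, no named facts) for the discharge of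
`Literature.Geometry.Riemannian.ggsu_boundary_sphere_of_nonTrapping_of_nonpos`
(`SimpleAHBoundarySphere.lean`; Graham–Guillarmou–Stefanov–Uhlmann, Ann. Inst. Fourier 69 (2019),
§5.1 and the proof of Prop. 5.13: the exit time `τ₊` of the rescaled flow is smooth and the rays
from an interior point sweep out the compactified manifold).

Setting: a complete Riemannian manifold `(M, g)` with a smooth function `u > 0` (`u = ρ ∘ j`, the
boundary defining function pulled back to the interior), **non-trapping** (every non-constant
geodesic leaves every compact set), **proper** (`{u ≥ s}` compact for `s > 0`) and **convex near
infinity** with threshold `ε₀` (`SimpleAH.exists_convexity_threshold`: along unit speed geodesics,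
`u ∘ γ < ε₀` and `(u ∘ γ)' = 0` force `(u ∘ γ)'' < 0`). For a base point `p` and a level
`0 < ε < min ε₀ (u p)` we prove:

* `exists_unique_crossing` — every unit speed ray `γ_v` from `p` crosses `{u = ε}` exactly once, at
  a time `T > 0`, transversally (`(u ∘ γ_v)'(T) < 0`), with `u ∘ γ_v > ε` before and `< ε` after;
* `exists_smooth_exitTime` — the crossing time is the restriction of a function `τ` smooth on a
  neighbourhood of the unit sphere of `T_pM` (implicit function theorem, the tree's
  `exists_contMDiffOn_firstExit`);
* `exists_homeomorph_preimage_superlevel` — `exp_p⁻¹{u ≥ ε}` is a star-shaped subset of `T_pM`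
  containing `0`, homeomorphic to the closed unit ball (radial function `τ`).

## References

* C. R. Graham, C. Guillarmou, P. Stefanov, G. Uhlmann, Ann. Inst. Fourier 69 (2019), §2.2,
  §5.1, Prop. 5.13. [GrahamEtAl2020]
* G. P. Paternain, M. Salo, G. Uhlmann, *Geometric inverse problems* (2023), Lemma 3.2.3,
  Prop. 3.8.5. [PaternainSaloUhlmann2023]
-/

noncomputable section

open Bundle Set Filter Function Metric
open scoped Manifold ContDiff Topology

namespace Literature.Geometry.Riemannian

namespace SimpleAH

open Literature.Geometry.Lorentzian
open Literature.Geometry.Lorentzian.PseudoRiemannianMetric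

/-! ### One-variable lemmas -/

section Real

/-- A function with positive derivative at `x` is below its value just to the left of `x`.
[folklore] -/
theorem eventually_lt_left_of_hasDerivAt_pos {f : ℝ → ℝ} {f' x : ℝ} (hf : HasDerivAt f f' x)
    (h : 0 < f') : ∀ᶠ t in 𝓝[<] x, f t < f x := by
  have ht : Tendsto (slope f x) (𝓝[≠] x) (𝓝 f') := hasDerivAt_iff_tendsto_slope.1 hf
  have hev : ∀ᶠ t in 𝓝[≠] x, 0 < slope f x t := ht.eventually (lt_mem_nhds h)
  have hev' : ∀ᶠ t in 𝓝[<] x, 0 < slope f x t :=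
    hev.filter_mono (nhdsWithin_mono _ fun t ht ↦ ne_of_lt ht)
  filter_upwards [hev', self_mem_nhdsWithin] with t hpos htx
  rw [slope_def_field] at hpos
  have hneg : t - x < 0 := sub_neg.2 htx
  have := (div_pos_iff.1 hpos)
  rcases this with ⟨h1, h2⟩ | ⟨h1, h2⟩
  · exact absurd h2 (not_lt.2 hneg.le)
  · linarith

/-- A function with negative derivative at `x` is above its value just to the left of `x`.
[folklore] -/
theorem eventually_gt_left_of_hasDerivAt_neg {f : ℝ → ℝ} {f' x : ℝ} (hf : HasDerivAt f f' x)
    (h : f' < 0) : ∀ᶠ t in 𝓝[<] x, f x < f t := by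
  have h' := eventually_lt_left_of_hasDerivAt_pos hf.neg (neg_pos.2 h)
  filter_upwards [h'] with t ht
  simpa using ht

/-- A function with negative derivative at `x` is below its value just to the right of `x`.
[folklore] -/
theorem eventually_lt_right_of_hasDerivAt_neg {f : ℝ → ℝ} {f' x : ℝ} (hf : HasDerivAt f f' x)
    (h : f' < 0) : ∀ᶠ t in 𝓝[>] x, f t < f x := by
  have ht : Tendsto (slope f x) (𝓝[≠] x) (𝓝 f') := hasDerivAt_iff_tendsto_slope.1 hf
  have hev : ∀ᶠ t in 𝓝[≠] x, slope f x t < 0 := ht.eventually (gt_mem_nhds h)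
  have hev' : ∀ᶠ t in 𝓝[>] x, slope f x t < 0 :=
    hev.filter_mono (nhdsWithin_mono _ fun t ht ↦ ne_of_gt ht)
  filter_upwards [hev', self_mem_nhdsWithin] with t hneg htx
  rw [slope_def_field] at hneg
  have hpos : 0 < t - x := sub_pos.2 htx
  rcases div_neg_iff.1 hneg with ⟨h1, h2⟩ | ⟨h1, h2⟩
  · exact absurd h2 (not_lt.2 hpos.le)
  · linarith

/-- **Persistence of a negative slope.** Let `f` be `C²`, `f' a < 0`, `f a < ε₀`, and suppose that
for `t ≥ a` with `f t < ε₀` a vanishing first derivative forces `f'' t < 0`. Then `f' < 0` on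
`[a, ∞)`: at the first zero `t*` of `f'` after `a`, `f` would still be below `ε₀` (it decreased),
so `f''(t*) < 0`, contradicting `f' < 0` just before `t*`. [folklore] -/
theorem deriv_neg_of_no_tangency {f : ℝ → ℝ} (hf : ContDiff ℝ 2 f) {a ε₀ : ℝ}
    (ha : deriv f a < 0) (hfa : f a < ε₀)
    (hP : ∀ t, a ≤ t → f t < ε₀ → deriv f t = 0 → deriv (deriv f) t < 0) :
    ∀ t, a ≤ t → deriv f t < 0 := by
  have hf1 : ContDiff ℝ 1 (deriv f) := hf.deriv'
  have hdc : Continuous (deriv f) := hf1.continuous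
  have hfd : ∀ t, HasDerivAt f (deriv f t) t := fun t ↦
    (hf.differentiable (by norm_num) t).hasDerivAt
  have hfdd : ∀ t, HasDerivAt (deriv f) (deriv (deriv f) t) t := fun t ↦
    (hf1.differentiable one_ne_zero t).hasDerivAt
  by_contra hcon
  push Not at hcon
  -- the first time after `a` where `f' ≥ 0`
  set Z : Set ℝ := {t | a ≤ t ∧ 0 ≤ deriv f t} with hZ
  obtain ⟨t₁, ht₁a, ht₁⟩ := hcon
  have hZne : Z.Nonempty := ⟨t₁, ht₁a, ht₁⟩
  have hZbdd : BddBelow Z := ⟨a, fun t ht ↦ ht.1⟩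
  have hZclosed : IsClosed Z :=
    (isClosed_le continuous_const continuous_id).inter (isClosed_le continuous_const hdc)
  set ts := sInf Z with hts
  have htsZ : ts ∈ Z := hZclosed.csInf_mem hZne hZbdd
  have hats : a < ts := lt_of_le_of_ne htsZ.1 fun h ↦ by
    rw [← h] at htsZ; exact absurd htsZ.2 (not_le.2 ha)
  -- before `ts`, `f' < 0`
  have hneg : ∀ t, a ≤ t → t < ts → deriv f t < 0 := by
    intro t hat hlt
    by_contra h
    exact absurd (csInf_le hZbdd ⟨hat, not_lt.1 h⟩) (not_le.2 hlt)
  -- hence `f ts < ε₀`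
  have hanti : StrictAntiOn f (Icc a ts) :=
    strictAntiOn_of_deriv_neg (convex_Icc a ts) hf.continuous.continuousOn fun t ht ↦ by
      rw [interior_Icc] at ht
      exact hneg t ht.1.le ht.2
  have hfts : f ts < ε₀ := (hanti (left_mem_Icc.2 hats.le) (right_mem_Icc.2 hats.le) hats).trans hfa
  -- `f' ts = 0`
  have hle : deriv f ts ≤ 0 := by
    have htend : Tendsto (deriv f) (𝓝[<] ts) (𝓝 (deriv f ts)) :=
      hdc.continuousAt.continuousWithinAt.tendsto
    refine le_of_tendsto htend ?_
    have hev : ∀ᶠ t in 𝓝[<] ts, a < t := by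
      exact Filter.Eventually.filter_mono nhdsWithin_le_nhds (lt_mem_nhds hats)
    filter_upwards [hev, self_mem_nhdsWithin] with t hat hlt
    exact (hneg t hat.le hlt).le
  have hzero : deriv f ts = 0 := le_antisymm hle htsZ.2
  -- so `f'' ts < 0`, and `f' > 0` just before `ts`: contradiction
  have hdd : deriv (deriv f) ts < 0 := hP ts htsZ.1 hfts hzero
  have hev := eventually_gt_left_of_hasDerivAt_neg (hfdd ts) hdd
  rw [hzero] at hev
  have hev2 : ∀ᶠ t in 𝓝[<] ts, a < t := Filter.Eventually.filter_mono nhdsWithin_le_nhds (lt_mem_nhds hats)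
  obtain ⟨t, ⟨hpos, hat⟩, hlt⟩ := ((hev.and hev2).and self_mem_nhdsWithin).exists
  exact absurd hpos (not_lt.2 (hneg t hat.le hlt).le)

/-- **First crossing of a level from above.** If `f` is continuous, `ε < f 0` and eventually
`f < ε` on `[0, ∞)`, there is a first time `s₁ > 0` with `f s₁ = ε` and `ε < f` on `[0, s₁)`.
[folklore] -/
theorem exists_first_crossing_from_above {f : ℝ → ℝ} (hf : Continuous f) {ε : ℝ} (h0 : ε < f 0)
    {T₁ : ℝ} (hT₁ : ∀ t, T₁ ≤ t → f t < ε) :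
    ∃ s₁ : ℝ, 0 < s₁ ∧ f s₁ = ε ∧ ∀ t ∈ Ico 0 s₁, ε < f t := by
  set Z : Set ℝ := {t | 0 ≤ t ∧ f t ≤ ε} with hZ
  have hZne : Z.Nonempty := ⟨max T₁ 0, le_max_right _ _, (hT₁ _ (le_max_left _ _)).le⟩
  have hZbdd : BddBelow Z := ⟨0, fun t ht ↦ ht.1⟩
  have hZclosed : IsClosed Z :=
    (isClosed_le continuous_const continuous_id).inter (isClosed_le hf continuous_const)
  set s₁ := sInf Z with hs₁
  have hs₁Z : s₁ ∈ Z := hZclosed.csInf_mem hZne hZbdd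
  have hbefore : ∀ t ∈ Ico 0 s₁, ε < f t := by
    intro t ht
    by_contra h
    exact absurd (csInf_le hZbdd ⟨ht.1, not_lt.1 h⟩) (not_le.2 ht.2)
  have hpos : 0 < s₁ := lt_of_le_of_ne hs₁Z.1 fun h ↦ by
    rw [← h] at hs₁Z; exact absurd hs₁Z.2 (not_le.2 h0)
  refine ⟨s₁, hpos, le_antisymm hs₁Z.2 ?_, hbefore⟩
  -- `f s₁ ≥ ε` by continuity from the left
  have htend : Tendsto f (𝓝[<] s₁) (𝓝 (f s₁)) := hf.continuousAt.continuousWithinAt.tendsto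
  refine ge_of_tendsto htend ?_
  have hev : ∀ᶠ t in 𝓝[<] s₁, 0 < t := Filter.Eventually.filter_mono nhdsWithin_le_nhds (lt_mem_nhds hpos)
  filter_upwards [hev, self_mem_nhdsWithin] with t ht hlt
  exact (hbefore t ⟨ht.le, hlt⟩).le

end Real

/-! ### The crossing structure of the unit speed rays from a point -/

section Rays

variable {E : Type*} [NormedAddCommGroup E] [NormedSpace ℝ E] {H : Type*} [TopologicalSpace H]
  {I : ModelWithCorners ℝ E H} {M : Type*} [TopologicalSpace M] [ChartedSpace H M]
  [IsManifold I ∞ M] [FiniteDimensional ℝ E] [CompleteSpace E] [T2Space M] [I.Boundaryless]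
  {g : PseudoRiemannianMetric I ∞ E (TangentSpace I : M → Type _)} [g.HasLeviCivita]
  [CovariantDerivative.ContMDiffCovariantDerivative g.leviCivita 1]
  [CovariantDerivative.ContMDiffCovariantDerivative g.leviCivita ∞]

/-- The maximal geodesic of a complete connection, as a smooth curve `ℝ → M`. [folklore] -/
theorem contMDiff_maximalGeodesic_curve (hc : IsGeodesicallyComplete g.leviCivita) (p : M)
    (v : TangentSpace I p) : ContMDiff 𝓘(ℝ, ℝ) I ∞ (maximalGeodesic g.leviCivita p v) := by
  have h := (contMDiff_maximalGeodesic_family hc p).comp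
    (contMDiff_id.prodMk (contMDiff_const (c := (show E from v))))
  exact h

/-- A real function along a maximal geodesic of a complete connection is smooth. [folklore] -/
theorem contDiff_comp_maximalGeodesic (hc : IsGeodesicallyComplete g.leviCivita) {u : M → ℝ}
    (hu : ContMDiff I 𝓘(ℝ, ℝ) ∞ u) (p : M) (v : TangentSpace I p) :
    ContDiff ℝ ∞ fun s ↦ u (maximalGeodesic g.leviCivita p v s) :=
  (hu.comp (contMDiff_maximalGeodesic_curve hc p v)).contDiff

/-- **Unique transversal crossing of a small level by the rays from a point** (GGSU 2019, §2.2 and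
§5.1; the level-set form of "the regions `{ρ ≥ ε}` are strictly convex"). Let `(M, g)` be complete
with a smooth `u`, non-trapping, `{u ≥ s}` compact for `s > 0`, and convex near infinity with
threshold `ε₀` along unit speed geodesics. For `0 < ε < ε₀`, `ε < u p` and a `g`-unit vector `v`
at `p`, the ray `γ_v` crosses `{u = ε}` at exactly one time `T > 0`: `u ∘ γ_v > ε` on `[0, T)`,
`u(γ_v T) = ε`, `(u ∘ γ_v)' < 0` on `[T, ∞)` and `u ∘ γ_v < ε` on `(T, ∞)`.
[cite: GrahamEtAl2020, §2.2 (Lemma 2.3 ff.) and §5.1] -/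
theorem exists_unique_crossing (hc : IsGeodesicallyComplete g.leviCivita) {u : M → ℝ}
    (hu : ContMDiff I 𝓘(ℝ, ℝ) ∞ u)
    (hNT : ∀ γ : ℝ → M, IsGeodesic g.leviCivita γ → velocity I γ 0 ≠ 0 →
      ∀ K : Set M, IsCompact K → ∃ T : ℝ, ∀ t, T ≤ t → γ t ∉ K)
    (hprop : ∀ s : ℝ, 0 < s → IsCompact {x | s ≤ u x})
    {ε₀ : ℝ} (hconv : ∀ γ : ℝ → M, IsGeodesic g.leviCivita γ → ∀ t : ℝ,
      g.val (γ t) (velocity I γ t) (velocity I γ t) = 1 → u (γ t) < ε₀ →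
      deriv (fun s ↦ u (γ s)) t = 0 → deriv (deriv fun s ↦ u (γ s)) t < 0)
    (p : M) {ε : ℝ} (hε : 0 < ε) (hεε₀ : ε < ε₀) (hεp : ε < u p)
    (v : TangentSpace I p) (hv : g.val p v v = 1) :
    ∃ T : ℝ, 0 < T ∧ u (maximalGeodesic g.leviCivita p v T) = ε ∧
      (∀ t ∈ Ico 0 T, ε < u (maximalGeodesic g.leviCivita p v t)) ∧
      (∀ t, T ≤ t → deriv (fun s ↦ u (maximalGeodesic g.leviCivita p v s)) t < 0) ∧
      (∀ t, T < t → u (maximalGeodesic g.leviCivita p v t) < ε) := by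
  obtain ⟨-, hgeo, h0, hv0⟩ := maximalGeodesic_of_isGeodesicallyComplete hc p v
  set γ := maximalGeodesic g.leviCivita p v with hγ
  set f : ℝ → ℝ := fun s ↦ u (γ s) with hf
  have hfs : ContDiff ℝ ∞ f := contDiff_comp_maximalGeodesic hc hu p v
  have hf2 : ContDiff ℝ 2 f := hfs.of_le (WithTop.coe_le_coe.2 le_top)
  have hfc : Continuous f := hfs.continuous
  have hfd : ∀ t, HasDerivAt f (deriv f t) t := fun t ↦
    (hfs.differentiable (by simp) t).hasDerivAt
  have hf1 : ContDiff ℝ 1 (deriv f) := hf2.deriv'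
  have hfdd : ∀ t, HasDerivAt (deriv f) (deriv (deriv f) t) t := fun t ↦
    (hf1.differentiable one_ne_zero t).hasDerivAt
  -- unit speed along `γ`, and `γ'(0) = v ≠ 0`
  have hunit : ∀ t, g.val (γ t) (velocity I γ t) (velocity I γ t) = 1 := fun t ↦ by
    rw [hγ, val_velocity_maximalGeodesic hc p v t]; exact hv
  have hvne : velocity I γ 0 ≠ 0 := by
    intro h
    have hvz : v = 0 := by rw [← hv0]; exact h
    rw [hvz, map_zero] at hv
    exact zero_ne_one hv
  have hP : ∀ t, f t < ε₀ → deriv f t = 0 → deriv (deriv f) t < 0 :=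
    fun t ↦ hconv γ hgeo t (hunit t)
  -- the ray leaves `{u ≥ ε}`
  obtain ⟨T₁, hT₁⟩ := hNT γ hgeo hvne {x | ε ≤ u x} (hprop ε hε)
  have hT₁' : ∀ t, T₁ ≤ t → f t < ε := fun t ht ↦ not_le.1 (hT₁ t ht)
  -- the first crossing
  have hf0 : ε < f 0 := by show ε < u (γ 0); rw [h0]; exact hεp
  obtain ⟨s₁, hs₁, hfs₁, hbefore⟩ := exists_first_crossing_from_above hfc hf0 hT₁'
  -- transversality at the first crossing
  have hds₁ : deriv f s₁ < 0 := by
    rcases lt_trichotomy (deriv f s₁) 0 with h | h | h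
    · exact h
    · exfalso
      have hdd : deriv (deriv f) s₁ < 0 := hP s₁ (by rw [hfs₁]; exact hεε₀) h
      have hev := eventually_gt_left_of_hasDerivAt_neg (hfdd s₁) hdd
      rw [h] at hev
      obtain ⟨l, hl, hlsub⟩ := mem_nhdsLT_iff_exists_Ioo_subset.1 hev
      set l' := max l 0 with hl'
      have hl's : l' < s₁ := max_lt hl hs₁
      have hmono : StrictMonoOn f (Icc l' s₁) :=
        strictMonoOn_of_deriv_pos (convex_Icc l' s₁) hfc.continuousOn fun t ht ↦ by
          rw [interior_Icc] at ht
          exact hlsub ⟨(le_max_left _ _).trans_lt ht.1, ht.2⟩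
      set t := (l' + s₁) / 2 with ht
      have ht1 : l' < t := by rw [ht]; linarith
      have ht2 : t < s₁ := by rw [ht]; linarith
      have h1 : f t < f s₁ := hmono ⟨ht1.le, ht2.le⟩ (right_mem_Icc.2 hl's.le) ht2
      have h2 : ε < f t := hbefore t ⟨(le_max_right _ _).trans ht1.le, ht2⟩
      rw [hfs₁] at h1
      exact absurd h1 (not_lt.2 h2.le)
    · exfalso
      have hev := eventually_lt_left_of_hasDerivAt_pos (hfd s₁) h
      have hev2 : ∀ᶠ t in 𝓝[<] s₁, 0 < t :=
        Filter.Eventually.filter_mono nhdsWithin_le_nhds (lt_mem_nhds hs₁)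
      obtain ⟨t, ⟨hlt, hpos⟩, hts⟩ := ((hev.and hev2).and self_mem_nhdsWithin).exists
      rw [hfs₁] at hlt
      exact absurd hlt (not_lt.2 (hbefore t ⟨hpos.le, hts⟩).le)
  -- the slope stays negative after the first crossing
  have hneg : ∀ t, s₁ ≤ t → deriv f t < 0 :=
    deriv_neg_of_no_tangency hf2 hds₁ (by rw [hfs₁]; exact hεε₀) fun t _ ↦ hP t
  have hanti : StrictAntiOn f (Ici s₁) :=
    strictAntiOn_of_deriv_neg (convex_Ici s₁) hfc.continuousOn fun t ht ↦ by
      rw [interior_Ici] at ht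
      exact hneg t (le_of_lt ht)
  refine ⟨s₁, hs₁, hfs₁, hbefore, hneg, fun t ht ↦ ?_⟩
  have h := hanti self_mem_Ici (mem_Ici.2 ht.le) ht
  rwa [hfs₁] at h

end Rays

/-! ### The exit time as a smooth function near the unit sphere; the star-shaped preimage -/

section ExitTime

variable {E : Type*} [NormedAddCommGroup E] [NormedSpace ℝ E] {H : Type*} [TopologicalSpace H]
  {I : ModelWithCorners ℝ E H} {M : Type*} [TopologicalSpace M] [ChartedSpace H M]
  [IsManifold I ∞ M] [FiniteDimensional ℝ E] [CompleteSpace E] [T2Space M] [I.Boundaryless]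
  {g : PseudoRiemannianMetric I ∞ E (TangentSpace I : M → Type _)} [g.HasLeviCivita]
  [CovariantDerivative.ContMDiffCovariantDerivative g.leviCivita 1]
  [CovariantDerivative.ContMDiffCovariantDerivative g.leviCivita ∞]

/-- **The exit structure of the rays from a point** (GGSU 2019, §5.1: the exit time `τ₊` is a
smooth positive function; Prop. 5.13, proof; PSU 2023, Lemma 3.2.3 and Prop. 3.8.5). In the setting
of `exists_unique_crossing` (complete `(M, g)`, smooth `u`, non-trapping, proper, convex near
infinity with threshold `ε₀`; base point `p`, level `0 < ε < min ε₀ (u p)`): there are an open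
neighbourhood `U` of the `g_p`-unit sphere of `T_pM = E` and a function `τ`, `C^∞` on `U`, such that
for every unit `v` the ray `γ_v` has `u ∘ γ_v > ε` on `[0, τ v)`, `u(γ_v(τ v)) = ε`, `u ∘ γ_v < ε` on
`(τ v, ∞)` (`τ v > 0`); and the set `K = exp_p⁻¹{u ≥ ε}` contains `0`, is star-shaped about `0`
and is homeomorphic to the closed unit ball (radial function `τ(v/|v|_g) ‖v/|v|_g‖`).
[cite: GrahamEtAl2020, §5.1 and Prop. 5.13 (proof)] -/
theorem exit_structure (hc : IsGeodesicallyComplete g.leviCivita) (hg : g.IsRiemannian)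
    {u : M → ℝ} (hu : ContMDiff I 𝓘(ℝ, ℝ) ∞ u)
    (hNT : ∀ γ : ℝ → M, IsGeodesic g.leviCivita γ → velocity I γ 0 ≠ 0 →
      ∀ K : Set M, IsCompact K → ∃ T : ℝ, ∀ t, T ≤ t → γ t ∉ K)
    (hprop : ∀ s : ℝ, 0 < s → IsCompact {x | s ≤ u x})
    {ε₀ : ℝ} (hconv : ∀ γ : ℝ → M, IsGeodesic g.leviCivita γ → ∀ t : ℝ,
      g.val (γ t) (velocity I γ t) (velocity I γ t) = 1 → u (γ t) < ε₀ →
      deriv (fun s ↦ u (γ s)) t = 0 → deriv (deriv fun s ↦ u (γ s)) t < 0)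
    (p : M) {ε : ℝ} (hε : 0 < ε) (hεε₀ : ε < ε₀) (hεp : ε < u p)
    {K : Set E} (hK : K = {w : E | ε ≤ u (expMap g.leviCivita p w)}) :
    ∃ (U : Set E) (τ : E → ℝ), IsOpen U ∧ {v : E | g.val p v v = 1} ⊆ U ∧ ContDiffOn ℝ ∞ τ U ∧
      (∀ v : E, g.val p v v = 1 → 0 < τ v ∧
        u (maximalGeodesic g.leviCivita p v (τ v)) = ε ∧
        (∀ t ∈ Ico 0 (τ v), ε < u (maximalGeodesic g.leviCivita p v t)) ∧
        (∀ t, τ v < t → u (maximalGeodesic g.leviCivita p v t) < ε)) ∧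
      (0 : E) ∈ K ∧ StarConvex ℝ (0 : E) K ∧ Nonempty (K ≃ₜ closedBall (0 : E) 1) := by
  set B : E →L[ℝ] E →L[ℝ] ℝ := g.val p with hB
  -- the family `F(v, t) = -u(γ_v(t))`
  set F : E × ℝ → ℝ := fun q ↦ -u (maximalGeodesic g.leviCivita p q.1 q.2) with hF
  have hFs : ContMDiff (𝓘(ℝ, E).prod 𝓘(ℝ, ℝ)) 𝓘(ℝ, ℝ) ∞ F := by
    have hswap : ContMDiff (𝓘(ℝ, E).prod 𝓘(ℝ, ℝ)) (𝓘(ℝ, ℝ).prod 𝓘(ℝ, E)) ∞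
        (fun q : E × ℝ ↦ (q.2, q.1)) := contMDiff_snd.prodMk contMDiff_fst
    have h1 := (contMDiff_maximalGeodesic_family hc p).comp hswap
    have h2 := hu.comp h1
    exact (contDiff_neg.contMDiff).comp h2
  -- transversal first exits of the level `-ε` on the unit sphere
  set Sph : Set E := {v : E | B v v = 1} with hSph
  have hSphK : ∀ v ∈ Sph, ∃ t₁, 0 < t₁ ∧ F (v, t₁) = -ε ∧ 0 < deriv (fun s ↦ F (v, s)) t₁ ∧
      ∀ t ∈ Ico 0 t₁, F (v, t) < -ε := by
    intro v hv
    obtain ⟨T, hT, hTε, hbefore, hneg, -⟩ :=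
      exists_unique_crossing hc hu hNT hprop hconv p hε hεε₀ hεp v hv
    refine ⟨T, hT, by simp only [hF, hTε], ?_, fun t ht ↦ by simp only [hF]; linarith [hbefore t ht]⟩
    have hd : deriv (fun s ↦ F (v, s)) T =
        -deriv (fun s ↦ u (maximalGeodesic g.leviCivita p v s)) T := by
      simp only [hF]
      exact deriv.neg
    rw [hd]
    linarith [hneg T le_rfl]
  obtain ⟨U, hUo, hSU, τ, hτs, hτ⟩ := exists_contMDiffOn_firstExit (J := 𝓘(ℝ, E)) hFs hSphK
  have hτd : ContDiffOn ℝ ∞ τ U := contMDiffOn_iff_contDiffOn.1 hτs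
  -- the structure along unit rays, with `τ`
  have hstruct : ∀ v : E, B v v = 1 → 0 < τ v ∧
      u (maximalGeodesic g.leviCivita p v (τ v)) = ε ∧
      (∀ t ∈ Ico 0 (τ v), ε < u (maximalGeodesic g.leviCivita p v t)) ∧
      (∀ t, τ v < t → u (maximalGeodesic g.leviCivita p v t) < ε) := by
    intro v hv
    obtain ⟨h1, h2, -, h4⟩ := hτ v (hSU hv)
    obtain ⟨T, hT, hTε, hbefore, -, hafter⟩ :=
      exists_unique_crossing hc hu hNT hprop hconv p hε hεε₀ hεp v hv
    have h2' : u (maximalGeodesic g.leviCivita p v (τ v)) = ε := by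
      simp only [hF] at h2; linarith
    have h4' : ∀ t ∈ Ico 0 (τ v), ε < u (maximalGeodesic g.leviCivita p v t) := by
      intro t ht; have := h4 t ht; simp only [hF] at this; linarith
    -- `τ v = T` by uniqueness of first crossings
    have hτT : τ v = T := by
      refine firstCrossing_unique (F := fun q : E × ℝ ↦ -u (maximalGeodesic g.leviCivita p q.1 q.2))
        (x := v) (ε := -ε) h1 (by simp only [h2']) (fun t ht ↦ ?_) hT (by simp only [hTε])
        (fun t ht ↦ ?_)
      · simp only; linarith [h4' t ht]
      · simp only; linarith [hbefore t ht]
    refine ⟨h1, h2', h4', fun t ht ↦ hafter t ?_⟩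
    rwa [← hτT]
  refine ⟨U, τ, hUo, hSU, hτd, hstruct, ?_⟩
  -- the `g_p`-norm and the normalization
  obtain ⟨c, hc0, hcv⟩ := exists_pos_mul_norm_sq_le_val_point (g := g) hg p
  have hcv' : ∀ v : E, c * ‖v‖ ^ 2 ≤ B v v := hcv
  have hpos : ∀ w : E, w ≠ 0 → 0 < B w w := fun w hw ↦ hg p w hw
  have hnn : ∀ w : E, 0 ≤ B w w := fun w ↦ by
    by_cases hw : w = 0
    · rw [hw]; simp
    · exact (hpos w hw).le
  set Nm : E → ℝ := fun w ↦ Real.sqrt (B w w) with hNm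
  have hNmpos : ∀ w : E, w ≠ 0 → 0 < Nm w := fun w hw ↦ Real.sqrt_pos.2 (hpos w hw)
  have hNmsq : ∀ w : E, Nm w ^ 2 = B w w := fun w ↦ Real.sq_sqrt (hnn w)
  set nrm : E → E := fun w ↦ (Nm w)⁻¹ • w with hnrm
  have hBsmul : ∀ (a : ℝ) (w : E), B (a • w) (a • w) = a ^ 2 * B w w := by
    intro a w
    simp only [map_smul, smul_apply, smul_eq_mul]
    ring
  have hnrm_unit : ∀ w : E, w ≠ 0 → B (nrm w) (nrm w) = 1 := by
    intro w hw
    simp only [hnrm]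
    rw [hBsmul, ← hNmsq w, inv_pow]
    exact inv_mul_cancel₀ (pow_ne_zero 2 (hNmpos w hw).ne')
  have hnrm_ne : ∀ w : E, w ≠ 0 → nrm w ≠ 0 := fun w hw h ↦ by
    have := hnrm_unit w hw; rw [h] at this; simp at this
  have hw_eq : ∀ w : E, w ≠ 0 → w = Nm w • nrm w := fun w hw ↦ by
    simp only [hnrm]
    rw [smul_smul, mul_inv_cancel₀ (hNmpos w hw).ne', one_smul]
  have hNa : ∀ (a : ℝ) (w : E), 0 < a → Nm (a • w) = a * Nm w := by
    intro a w ha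
    simp only [hNm]
    rw [hBsmul, Real.sqrt_mul (sq_nonneg a), Real.sqrt_sq ha.le]
  have hnrm_smul : ∀ (a : ℝ) (w : E), 0 < a → w ≠ 0 → nrm (a • w) = nrm w := by
    intro a w ha hw
    simp only [hnrm]
    rw [hNa a w ha, mul_inv, smul_smul, mul_comm (a⁻¹), mul_assoc, inv_mul_cancel₀ ha.ne', mul_one]
  -- `exp_p w = γ_{nrm w}(Nm w)`
  have hexp : ∀ w : E, w ≠ 0 → expMap g.leviCivita p w =
      maximalGeodesic g.leviCivita p (nrm w) (Nm w) := by
    intro w hw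
    conv_lhs => rw [hw_eq w hw]
    exact expMap_smul hc p _ (Nm w)
  -- membership in `K` off the origin: `Nm w ≤ τ (nrm w)`
  have hmem : ∀ w : E, w ≠ 0 → (w ∈ K ↔ Nm w ≤ τ (nrm w)) := by
    intro w hw
    obtain ⟨h1, h2, h3, h4⟩ := hstruct (nrm w) (hnrm_unit w hw)
    rw [hK, mem_setOf_eq, hexp w hw]
    constructor
    · intro h
      by_contra hlt
      exact absurd (h4 _ (not_le.1 hlt)) (not_lt.2 h)
    · intro h
      rcases h.lt_or_eq with hlt | heq
      · exact (h3 _ ⟨(hNmpos w hw).le, hlt⟩).le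
      · rw [heq, h2]
  -- the radial function `s w = τ (nrm w) ‖nrm w‖`
  set s : E → ℝ := fun w ↦ τ (nrm w) * ‖nrm w‖ with hs
  have hnorm_eq : ∀ w : E, w ≠ 0 → ‖w‖ = Nm w * ‖nrm w‖ := by
    intro w hw
    conv_lhs => rw [hw_eq w hw]
    rw [norm_smul, Real.norm_eq_abs, abs_of_pos (hNmpos w hw)]
  have hs_mem : ∀ w : E, w ≠ 0 → (w ∈ K ↔ ‖w‖ ≤ s w) := by
    intro w hw
    rw [hmem w hw, hs, hnorm_eq w hw]
    have hpos' : 0 < ‖nrm w‖ := norm_pos_iff.2 (hnrm_ne w hw)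
    exact (mul_le_mul_iff_of_pos_right hpos').symm
  have hKeq : K = {w : E | w = 0 ∨ ‖w‖ ≤ s w} := by
    ext w
    by_cases hw : w = 0
    · subst hw
      simp only [mem_setOf_eq, true_or, iff_true]
      rw [hK, mem_setOf_eq]
      have h0 : expMap g.leviCivita p (0 : E) = p := expMap_zero (cov := g.leviCivita) p
      rw [h0]
      exact hεp.le
    · rw [hs_mem w hw]
      simp only [mem_setOf_eq, hw, false_or]
  -- properties of `s`
  have hs_hom : ∀ ⦃a : ℝ⦄, 0 < a → ∀ w, s (a • w) = s w := by
    intro a ha w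
    by_cases hw : w = 0
    · subst hw; simp only [smul_zero]
    · simp only [hs]; rw [hnrm_smul a w ha hw]
  have hBcont : Continuous fun w : E ↦ B w w :=
    B.continuous₂.comp (continuous_id.prodMk continuous_id)
  have hnrm_cont : ∀ w : E, w ≠ 0 → ContinuousAt nrm w := by
    intro w hw
    have h1 : ContinuousAt Nm w := hBcont.continuousAt.sqrt
    exact (h1.inv₀ (hNmpos w hw).ne').smul continuousAt_id
  have hs_cont : ∀ w : E, w ≠ 0 → ContinuousAt s w := by
    intro w hw
    have hτc : ContinuousAt τ (nrm w) :=
      hτd.continuousOn.continuousAt (hUo.mem_nhds (hSU (hnrm_unit w hw)))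
    exact (hτc.comp (hnrm_cont w hw)).mul (continuous_norm.continuousAt.comp (hnrm_cont w hw))
  -- bounds for `s` on the compact unit sphere
  have hSph0 : ∀ v ∈ Sph, v ≠ 0 := by
    intro v hv h; rw [h] at hv; simp [hSph] at hv
  have hSphc : IsCompact Sph := by
    have hclosed : IsClosed Sph := isClosed_eq hBcont continuous_const
    refine Metric.isCompact_of_isClosed_isBounded hclosed ?_
    refine isBounded_iff_forall_norm_le.2 ⟨Real.sqrt (1 / c), fun v hv ↦ ?_⟩
    have h := hcv' v
    rw [show B v v = 1 from hv] at h
    rw [← Real.sqrt_sq (norm_nonneg v)]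
    exact Real.sqrt_le_sqrt (by rw [le_div_iff₀ hc0]; linarith)
  have hsS : ContinuousOn s Sph := fun v hv ↦ (hs_cont v (hSph0 v hv)).continuousWithinAt
  have hsSpos : ∀ v ∈ Sph, 0 < s v := by
    intro v hv
    have h1 : 0 < τ (nrm v) := (hstruct (nrm v) (hnrm_unit v (hSph0 v hv))).1
    exact mul_pos h1 (norm_pos_iff.2 (hnrm_ne v (hSph0 v hv)))
  obtain ⟨m, hm, hsm⟩ : ∃ m : ℝ, 0 < m ∧ ∀ v ∈ Sph, m ≤ s v := by
    by_cases hne : Sph.Nonempty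
    · obtain ⟨v₀, hv₀, hmin⟩ := hSphc.exists_isMinOn hne hsS
      exact ⟨s v₀, hsSpos v₀ hv₀, fun v hv ↦ hmin hv⟩
    · exact ⟨1, one_pos, fun v hv ↦ (hne ⟨v, hv⟩).elim⟩
  obtain ⟨Mx, hsM⟩ : ∃ Mx : ℝ, ∀ v ∈ Sph, s v ≤ Mx := by
    by_cases hne : Sph.Nonempty
    · obtain ⟨v₀, -, hmax⟩ := hSphc.exists_isMaxOn hne hsS
      exact ⟨s v₀, fun v hv ↦ hmax hv⟩
    · exact ⟨1, fun v hv ↦ (hne ⟨v, hv⟩).elim⟩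
  have hs_nrm : ∀ w : E, w ≠ 0 → s w = s (nrm w) := fun w hw ↦ by
    conv_lhs => rw [hw_eq w hw]
    exact hs_hom (hNmpos w hw) _
  have hsm' : ∀ w : E, w ≠ 0 → m ≤ s w := fun w hw ↦ by
    rw [hs_nrm w hw]; exact hsm _ (hnrm_unit w hw)
  have hsM' : ∀ w : E, w ≠ 0 → s w ≤ Mx := fun w hw ↦ by
    rw [hs_nrm w hw]; exact hsM _ (hnrm_unit w hw)
  obtain ⟨e, -, -⟩ := exists_homeomorph_radial_closedBall hm hs_cont hs_hom hsm' hsM'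
  refine ⟨?_, ?_, ⟨(Homeomorph.setCongr hKeq).trans e⟩⟩
  · rw [hKeq]; exact Or.inl rfl
  · -- star-convexity about `0`
    intro w hw a b ha hb hab
    rw [smul_zero, zero_add]
    by_cases hb0 : b = 0
    · rw [hb0, zero_smul, hKeq]; exact Or.inl rfl
    have hbpos : 0 < b := lt_of_le_of_ne hb (Ne.symm hb0)
    by_cases hw0 : w = 0
    · rw [hw0, smul_zero, hKeq]; exact Or.inl rfl
    rw [hKeq] at hw ⊢
    right
    rw [hs_hom hbpos, norm_smul, Real.norm_eq_abs, abs_of_pos hbpos]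
    have hw' : ‖w‖ ≤ s w := hw.resolve_left hw0
    have hb1 : b ≤ 1 := by linarith
    calc b * ‖w‖ ≤ 1 * ‖w‖ := mul_le_mul_of_nonneg_right hb1 (norm_nonneg _)
      _ = ‖w‖ := one_mul _
      _ ≤ s w := hw'

end ExitTime

end SimpleAH

end Literature.Geometry.Riemannian

end
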